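import Mathlib
import Literature.MathematicalPhysics.StatisticalMechanics.BarlowStacking
import Literature.MathematicalPhysics.StatisticalMechanics.HcpHomogeneous
import Summits.AtomisticToContinuum.Crystallization.Theorems.ExcessDecayLiouvillePhononStabilityCertFrame
import HarnessLib

/-!
# Linear patch rigidity of the relaxed hexagonal close packing

Stub `stub_hcpPatchRigid` of line `IdeatorOneSketch` (crux stmt-AtomisticToContinuum-15776,
`IsometryAtoms.MinimisingLawsHaveAtoms`): a linear isometry `f` of `ℝ³` with
`f '' hcpStacking a h ∩ B̄(0, 23a/20) = hcpStacking a h ∩ B̄(0, 23a/20)` maps `hcpStacking a h`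
onto itself, for `39/50 · a ≤ h ≤ 17/20 · a`.

Proof.  Write `u = barlowPos 0 1 0`, `v = barlowPos 0 0 1`, `t = barlowPos 1 0 0 = w + h e₃`,
`e = layerNormal h = h e₃`, so that `barlowPos k i j = i u + j v + L(k) (t - e) + k e`
(`barlowPos_decomp`).  The hypothesis says that `f` and `f⁻¹` map points of the stacking of norm
`≤ 23a/20` to points of the stacking.
* `layer_of_norm_le`: a point of the stacking of norm `≤ 23a/20` lies in a layer `k ∈ {0, ±1}`
  (`4 h² > (23a/20)²`);
* `even_of_neg_barlowPos_eq`: the antipode of a point of an odd layer is never a point of the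
  stacking (second coordinates `a√3/2 (j + 1/3)` never add up to `0`); hence `f (±u)`, `f (±v)`,
  being antipodal pairs of patch points, lie in layer `0` (`map_layer_zero`);
* `map_layerNormal`: `⟪f e, u⟫ = ⟪e, f⁻¹ u⟫ = 0`, `⟪f e, v⟫ = 0`, `‖f e‖ = h`, so `f e = ± e`;
* `map_layer_one`: `⟪f t, f e⟫ = ⟪t, e⟫ = h²` puts the patch point `f t` in layer `±1`;
* `image_subset_of_patch`: expanding `f (barlowPos k i j)` by linearity exhibits it as a
  `barlowPos (±k) i' j'`; equality follows by applying the inclusion to `f⁻¹`.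
-/

noncomputable section

open Literature.MathematicalPhysics.StatisticalMechanics

namespace Summit.AtomisticToContinuum.Crystallization.Theorems.IsometryAtomsMinimisingLawsHaveAtoms

open PhononStabilityCWC.Cert (inner_fin3)

/-! ## Coordinates -/

/-- First coordinate of the layer normal. -/
@[simp] theorem layerNormal_apply_zero (h : ℝ) : layerNormal h 0 = 0 := by simp [layerNormal]

/-- Second coordinate of the layer normal. -/
@[simp] theorem layerNormal_apply_one (h : ℝ) : layerNormal h 1 = 0 := by simp [layerNormal]

/-- Third coordinate of the layer normal. -/
@[simp] theorem layerNormal_apply_two (h : ℝ) : layerNormal h 2 = h := by simp [layerNormal]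

/-- The hcp label of layer `1` is `1`. -/
theorem haggLabel_alternating_one : haggLabel alternatingHagg 1 = 1 :=
  haggLabel_alternating_of_odd odd_one

/-- The hcp label of layer `-1` is `1`. -/
theorem haggLabel_alternating_neg_one : haggLabel alternatingHagg (-1) = 1 :=
  haggLabel_alternating_of_odd odd_neg_one

/-- Squared norm of a point of a Barlow stacking:
`‖barlowPos k i j‖² = a² (i² + i j + j² + L (i + j) + L²/3) + k² h²`, `L = haggLabel s k`. -/
theorem norm_barlowPos_sq (a h : ℝ) (s : ℤ → ℤ) (k i j : ℤ) :
    ‖barlowPos a h s k i j‖ ^ 2 =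
      a ^ 2 * ((i : ℝ) ^ 2 + i * j + j ^ 2 + (haggLabel s k : ℝ) * (i + j) +
        (haggLabel s k : ℝ) ^ 2 / 3) + (k : ℝ) ^ 2 * h ^ 2 := by
  have h0 : barlowPos a h s 0 0 0 = 0 := by simp [barlowPos]
  have h3 : (√3 : ℝ) ^ 2 = 3 := Real.sq_sqrt (by norm_num)
  rw [← dist_zero_right, ← h0, dist_barlowPos_sq]
  simp only [Int.cast_zero, sub_zero, haggLabel_zero]
  linear_combination (a ^ 2 / 4 * ((j : ℝ) + haggLabel s k / 3) ^ 2) * h3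

/-- The antipode of a point of layer `0` of hcp. -/
theorem neg_barlowPos_zero (a h : ℝ) (i j : ℤ) :
    -barlowPos a h alternatingHagg 0 i j = barlowPos a h alternatingHagg 0 (-i) (-j) := by
  ext l; fin_cases l <;> simp
  ring

/-- **Linear decomposition** of the points of hcp along `u = barlowPos 0 1 0`,
`v = barlowPos 0 0 1`, `t - e` (`t = barlowPos 1 0 0`, `e = layerNormal h`) and `e`. -/
theorem barlowPos_decomp (a h : ℝ) (k i j : ℤ) :
    barlowPos a h alternatingHagg k i j =
      (i : ℝ) • barlowPos a h alternatingHagg 0 1 0 +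
        (j : ℝ) • barlowPos a h alternatingHagg 0 0 1 +
        (haggLabel alternatingHagg k : ℝ) •
          (barlowPos a h alternatingHagg 1 0 0 - layerNormal h) +
        (k : ℝ) • layerNormal h := by
  ext l; fin_cases l <;> simp [haggLabel_alternating_one]
  all_goals ring

/-! ## The patch: layers `0, ±1` only -/

/-- A point of the stacking of norm `≤ 23a/20` lies in one of the layers `0, 1, -1`
(for `h ≥ 39a/50`: `4 h² > (23a/20)²`). -/
theorem layer_of_norm_le {a h : ℝ} (ha : 0 < a) (hh1 : 39 / 50 * a ≤ h) {k i j : ℤ}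
    (H : ‖barlowPos a h alternatingHagg k i j‖ ≤ 23 / 20 * a) : k = 0 ∨ k = 1 ∨ k = -1 := by
  have hR : (0 : ℝ) ≤ 23 / 20 * a := by positivity
  rw [← sq_le_sq₀ (norm_nonneg _) hR, norm_barlowPos_sq] at H
  set L : ℝ := (haggLabel alternatingHagg k : ℝ) with hL
  have hlat : 0 ≤ (i : ℝ) ^ 2 + i * j + j ^ 2 + L * (i + j) + L ^ 2 / 3 := by
    nlinarith [sq_nonneg ((i : ℝ) + j / 2 + L / 2), sq_nonneg ((j : ℝ) + L / 3)]
  have hA : 0 ≤ a ^ 2 * ((i : ℝ) ^ 2 + i * j + j ^ 2 + L * (i + j) + L ^ 2 / 3) :=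
    mul_nonneg (sq_nonneg a) hlat
  have hB : (k : ℝ) ^ 2 * h ^ 2 ≤ (23 / 20 * a) ^ 2 := by linarith
  have hlo : (39 / 50 * a) ^ 2 ≤ h ^ 2 := pow_le_pow_left₀ (by positivity) hh1 2
  have hC : (k : ℝ) ^ 2 * (39 / 50 * a) ^ 2 ≤ (23 / 20 * a) ^ 2 :=
    (mul_le_mul_of_nonneg_left hlo (sq_nonneg _)).trans hB
  have hk4 : (k : ℝ) ^ 2 < 4 := by
    by_contra! H4
    nlinarith [mul_le_mul_of_nonneg_right H4 (sq_nonneg (39 / 50 * a)), mul_pos ha ha]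
  have hk : k ^ 2 < 4 := by exact_mod_cast hk4
  have h1 : k < 2 := by nlinarith
  have h2 : -2 < k := by nlinarith
  omega

/-- The six in-plane neighbours `barlowPos 0 i j`, `i² + i j + j² = 1`, have norm `a ≤ 23a/20`. -/
theorem norm_barlowPos_zero_le {a : ℝ} (h : ℝ) (ha : 0 < a) {i j : ℤ}
    (hq : i ^ 2 + i * j + j ^ 2 = 1) :
    ‖barlowPos a h alternatingHagg 0 i j‖ ≤ 23 / 20 * a := by
  rw [← sq_le_sq₀ (norm_nonneg _) (by positivity), norm_barlowPos_sq, haggLabel_zero]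
  have hq' : (i : ℝ) ^ 2 + i * j + j ^ 2 = 1 := by exact_mod_cast hq
  have h1 : a ^ 2 * ((i : ℝ) ^ 2 + i * j + j ^ 2) = a ^ 2 := by rw [hq', mul_one]
  push_cast
  nlinarith [h1, sq_nonneg a]

/-- The point `t = barlowPos 1 0 0` above the origin has norm `√(a²/3 + h²) ≤ 23a/20`
(for `h ≤ 17a/20`). -/
theorem norm_barlowPos_one_le {a h : ℝ} (ha : 0 < a) (hh1 : 39 / 50 * a ≤ h)
    (hh2 : h ≤ 17 / 20 * a) : ‖barlowPos a h alternatingHagg 1 0 0‖ ≤ 23 / 20 * a := by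
  rw [← sq_le_sq₀ (norm_nonneg _) (by positivity), norm_barlowPos_sq, haggLabel_alternating_one]
  have hh0 : 0 ≤ h := by linarith
  have hhi : h ^ 2 ≤ (17 / 20 * a) ^ 2 := pow_le_pow_left₀ hh0 hh2 2
  push_cast
  nlinarith [sq_nonneg a]

/-- **No antipodes off the even layers**: if `-barlowPos k i j` is again a point of hcp then `k`
is even (for odd `k` the second coordinates `a√3/2 (j + 1/3)` of the two points cannot cancel). -/
theorem even_of_neg_barlowPos_eq {a h : ℝ} (ha : 0 < a) (hh : 0 < h) {k i j k' i' j' : ℤ}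
    (H : -barlowPos a h alternatingHagg k i j = barlowPos a h alternatingHagg k' i' j') :
    Even k := by
  by_contra hk
  have H2 := congrArg (fun x : EuclideanSpace ℝ (Fin 3) => x 2) H
  simp only [PiLp.neg_apply, barlowPos_apply_two] at H2
  have hsum : ((k : ℝ) + k') * h = 0 := by linear_combination -H2
  have hk' : k' = -k := by
    have h1 : (k : ℝ) + k' = 0 := (mul_eq_zero.1 hsum).resolve_right hh.ne'
    have h2 : k + k' = 0 := by exact_mod_cast h1
    omega
  subst hk'
  have hL : haggLabel alternatingHagg k = 1 := by rw [haggLabel_alternating, if_neg hk]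
  have hL' : haggLabel alternatingHagg (-k) = 1 := by
    rw [haggLabel_alternating, if_neg fun h' => hk (even_neg.1 h')]
  have H1 := congrArg (fun x : EuclideanSpace ℝ (Fin 3) => x 1) H
  simp only [PiLp.neg_apply, barlowPos_apply_one, hL, hL', Int.cast_one] at H1
  have hprod : a * √3 / 2 * (3 * ((j : ℝ) + j') + 2) = 0 := by
    linear_combination (-3 : ℝ) * H1
  have hne : a * √3 / 2 ≠ 0 := by positivity
  have hzero : 3 * ((j : ℝ) + j') + 2 = 0 := (mul_eq_zero.1 hprod).resolve_left hne
  have hint : 3 * (j + j') + 2 = 0 := by exact_mod_cast hzero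
  omega

/-! ## Where a patch-preserving linear isometry sends `u, v, e, t` -/

/-- An in-plane neighbour `barlowPos 0 i j` (`i² + ij + j² = 1`) is mapped into layer `0` by every
linear isometry mapping patch points into the stacking (its antipode is a patch point too). -/
theorem map_layer_zero {a h : ℝ} (ha : 0 < a) (hh1 : 39 / 50 * a ≤ h)
    (g : EuclideanSpace ℝ (Fin 3) ≃ₗᵢ[ℝ] EuclideanSpace ℝ (Fin 3))
    (hg : ∀ x ∈ hcpStacking a h, ‖x‖ ≤ 23 / 20 * a → g x ∈ hcpStacking a h)
    {i j : ℤ} (hq : i ^ 2 + i * j + j ^ 2 = 1) :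
    ∃ i' j' : ℤ,
      g (barlowPos a h alternatingHagg 0 i j) = barlowPos a h alternatingHagg 0 i' j' := by
  have hh0 : 0 < h := by linarith
  have hx := norm_barlowPos_zero_le h ha hq
  have hnx := norm_barlowPos_zero_le h ha (i := -i) (j := -j) (by linear_combination hq)
  obtain ⟨k', i', j', hgx⟩ :=
    hg (barlowPos a h alternatingHagg 0 i j) (barlowPos_mem 0 i j) hx
  obtain ⟨k'', i'', j'', hgnx⟩ :=
    hg (barlowPos a h alternatingHagg 0 (-i) (-j)) (barlowPos_mem 0 (-i) (-j)) hnx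
  have hgxn : ‖barlowPos a h alternatingHagg k' i' j'‖ ≤ 23 / 20 * a := by
    rw [← hgx, LinearIsometryEquiv.norm_map]; exact hx
  have hk' : k' = 0 ∨ k' = 1 ∨ k' = -1 := layer_of_norm_le ha hh1 hgxn
  have H : -barlowPos a h alternatingHagg k' i' j' = barlowPos a h alternatingHagg k'' i'' j'' := by
    rw [← hgx, ← map_neg, neg_barlowPos_zero, hgnx]
  have hev := even_of_neg_barlowPos_eq ha hh0 H
  rcases hk' with rfl | rfl | rfl
  · exact ⟨i', j', hgx⟩
  · exact absurd hev Int.not_even_one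
  · exact absurd hev (by decide)

/-- The layer normal is mapped to `±` itself: `⟪g e, u⟫ = ⟪e, g⁻¹ u⟫ = 0`, `⟪g e, v⟫ = 0` (the
preimages of `u, v` lie in layer `0`), and `‖g e‖ = ‖e‖ = h`. -/
theorem map_layerNormal {a h : ℝ} (ha : 0 < a) (hh1 : 39 / 50 * a ≤ h)
    (g : EuclideanSpace ℝ (Fin 3) ≃ₗᵢ[ℝ] EuclideanSpace ℝ (Fin 3))
    (hg' : ∀ x ∈ hcpStacking a h, ‖x‖ ≤ 23 / 20 * a → g.symm x ∈ hcpStacking a h) :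
    g (layerNormal h) = layerNormal h ∨ g (layerNormal h) = -layerNormal h := by
  obtain ⟨i₁, j₁, h₁⟩ := map_layer_zero ha hh1 g.symm hg' (i := 1) (j := 0) (by norm_num)
  obtain ⟨i₂, j₂, h₂⟩ := map_layer_zero ha hh1 g.symm hg' (i := 0) (j := 1) (by norm_num)
  have e1 := g.inner_map_eq_flip (layerNormal h) (barlowPos a h alternatingHagg 0 1 0)
  have e2 := g.inner_map_eq_flip (layerNormal h) (barlowPos a h alternatingHagg 0 0 1)
  rw [h₁, inner_fin3, inner_fin3] at e1
  rw [h₂, inner_fin3, inner_fin3] at e2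
  simp only [barlowPos_apply_zero, barlowPos_apply_one, barlowPos_apply_two, haggLabel_zero,
    layerNormal_apply_zero, layerNormal_apply_one, layerNormal_apply_two, Int.cast_zero,
    Int.cast_one] at e1 e2
  have c0 : g (layerNormal h) 0 = 0 := by
    have : g (layerNormal h) 0 * a = 0 := by linear_combination e1
    exact (mul_eq_zero.1 this).resolve_right ha.ne'
  have c1 : g (layerNormal h) 1 = 0 := by
    have : g (layerNormal h) 1 * (a * √3 / 2) = 0 := by linear_combination e2 - (a / 2) * c0
    exact (mul_eq_zero.1 this).resolve_right (by positivity)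
  have cn := g.inner_map_map (layerNormal h) (layerNormal h)
  rw [inner_fin3, inner_fin3, c0, c1] at cn
  simp only [layerNormal_apply_zero, layerNormal_apply_one, layerNormal_apply_two] at cn
  have c2 : g (layerNormal h) 2 = h ∨ g (layerNormal h) 2 = -h :=
    sq_eq_sq_iff_eq_or_eq_neg.1 (by linear_combination cn)
  rcases c2 with c2 | c2
  · left; ext l; fin_cases l <;> simp [c0, c1, c2]
  · right; ext l; fin_cases l <;> simp [c0, c1, c2]

/-- The point `t = barlowPos 1 0 0` above the origin is mapped into layer `ε`, where
`g e = ε e`: `⟪g t, g e⟫ = ⟪t, e⟫ = h²`. -/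
theorem map_layer_one {a h : ℝ} (ha : 0 < a) (hh1 : 39 / 50 * a ≤ h) (hh2 : h ≤ 17 / 20 * a)
    (g : EuclideanSpace ℝ (Fin 3) ≃ₗᵢ[ℝ] EuclideanSpace ℝ (Fin 3))
    (hg : ∀ x ∈ hcpStacking a h, ‖x‖ ≤ 23 / 20 * a → g x ∈ hcpStacking a h)
    {ε : ℤ} (hε : ε = 1 ∨ ε = -1) (he : g (layerNormal h) = (ε : ℝ) • layerNormal h) :
    ∃ μ ν : ℤ, g (barlowPos a h alternatingHagg 1 0 0) = barlowPos a h alternatingHagg ε μ ν := by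
  have hh0 : 0 < h := by linarith
  obtain ⟨k', μ, ν, hgt⟩ :=
    hg (barlowPos a h alternatingHagg 1 0 0) (barlowPos_mem 1 0 0)
      (norm_barlowPos_one_le ha hh1 hh2)
  have hin := g.inner_map_map (barlowPos a h alternatingHagg 1 0 0) (layerNormal h)
  rw [hgt, he, inner_fin3, inner_fin3] at hin
  simp only [barlowPos_apply_zero, barlowPos_apply_one, barlowPos_apply_two, PiLp.smul_apply,
    smul_eq_mul, layerNormal_apply_zero, layerNormal_apply_one, layerNormal_apply_two,
    haggLabel_alternating_one, Int.cast_one] at hin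
  have hk : ((k' : ℝ) * ε - 1) * (h * h) = 0 := by linear_combination hin
  have hk1 : (k' : ℝ) * ε = 1 := by
    have := (mul_eq_zero.1 hk).resolve_right (by positivity)
    linarith
  have hk2 : k' * ε = 1 := by exact_mod_cast hk1
  obtain rfl : k' = ε := by rcases hε with rfl | rfl <;> omega
  exact ⟨μ, ν, hgt⟩

/-- **One-sided rigidity**: a linear isometry `g` such that `g` and `g⁻¹` map the points of the
stacking of norm `≤ 23a/20` into the stacking maps the whole stacking into itself. -/
theorem image_subset_of_patch {a h : ℝ} (ha : 0 < a) (hh1 : 39 / 50 * a ≤ h)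
    (hh2 : h ≤ 17 / 20 * a) (g : EuclideanSpace ℝ (Fin 3) ≃ₗᵢ[ℝ] EuclideanSpace ℝ (Fin 3))
    (hg : ∀ x ∈ hcpStacking a h, ‖x‖ ≤ 23 / 20 * a → g x ∈ hcpStacking a h)
    (hg' : ∀ x ∈ hcpStacking a h, ‖x‖ ≤ 23 / 20 * a → g.symm x ∈ hcpStacking a h) :
    g '' hcpStacking a h ⊆ hcpStacking a h := by
  obtain ⟨ε, hε, he⟩ :
      ∃ ε : ℤ, (ε = 1 ∨ ε = -1) ∧ g (layerNormal h) = (ε : ℝ) • layerNormal h := by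
    rcases map_layerNormal ha hh1 g hg' with h1 | h1
    · exact ⟨1, Or.inl rfl, by rw [h1, Int.cast_one, one_smul]⟩
    · exact ⟨-1, Or.inr rfl, by rw [h1, Int.cast_neg, Int.cast_one, neg_smul, one_smul]⟩
  obtain ⟨α, β, hu⟩ := map_layer_zero ha hh1 g hg (i := 1) (j := 0) (by norm_num)
  obtain ⟨γ, δ, hv⟩ := map_layer_zero ha hh1 g hg (i := 0) (j := 1) (by norm_num)
  obtain ⟨μ, ν, hw⟩ := map_layer_one ha hh1 hh2 g hg hε he
  have hεL : haggLabel alternatingHagg ε = 1 := by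
    rcases hε with rfl | rfl
    · exact haggLabel_alternating_one
    · exact haggLabel_alternating_neg_one
  rintro _ ⟨_, ⟨k, i, j, rfl⟩, rfl⟩
  have hLε : haggLabel alternatingHagg (ε * k) = haggLabel alternatingHagg k := by
    rcases hε with rfl | rfl
    · rw [one_mul]
    · rw [neg_one_mul, haggLabel_alternating, haggLabel_alternating]
      simp only [even_neg]
  refine ⟨ε * k, i * α + j * γ + haggLabel alternatingHagg k * μ,
    i * β + j * δ + haggLabel alternatingHagg k * ν, ?_⟩
  rw [barlowPos_decomp a h k i j]
  simp only [map_add, map_sub, LinearIsometryEquiv.map_smul, hu, hv, hw, he]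
  ext l; fin_cases l <;> (simp [hLε, hεL]; ring)

/-- STUB S2 (hcp geometry). **Linear patch rigidity of relaxed hcp**: a linear isometry of `ℝ³`
mapping the 13-point patch `hcpStacking a h ∩ B̄(0, 23a/20)` (the origin and its first shell:
six in-plane neighbours at distance `a`, three above and three below at distance `√(a²/3 + h²)`)
onto itself maps the whole stacking onto itself, for `h/a ∈ [39/50, 17/20]`. -/
theorem stub_hcpPatchRigid : ∀ a h : ℝ, 0 < a → 39 / 50 * a ≤ h → h ≤ 17 / 20 * a →
    ∀ f : EuclideanSpace ℝ (Fin 3) ≃ₗᵢ[ℝ] EuclideanSpace ℝ (Fin 3),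
      f '' hcpStacking a h ∩ Metric.closedBall (0 : EuclideanSpace ℝ (Fin 3)) (23 / 20 * a) =
        hcpStacking a h ∩ Metric.closedBall (0 : EuclideanSpace ℝ (Fin 3)) (23 / 20 * a) →
      f '' hcpStacking a h = hcpStacking a h := by
  intro a h ha hh1 hh2 f hf
  have hg : ∀ x ∈ hcpStacking a h, ‖x‖ ≤ 23 / 20 * a → f x ∈ hcpStacking a h := by
    intro x hx hxn
    have hfx : f x ∈
        f '' hcpStacking a h ∩ Metric.closedBall (0 : EuclideanSpace ℝ (Fin 3)) (23 / 20 * a) :=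
      ⟨⟨x, hx, rfl⟩, mem_closedBall_zero_iff.2 (by rwa [f.norm_map])⟩
    rw [hf] at hfx
    exact hfx.1
  have hg' : ∀ x ∈ hcpStacking a h, ‖x‖ ≤ 23 / 20 * a → f.symm x ∈ hcpStacking a h := by
    intro x hx hxn
    have hfx : x ∈
        f '' hcpStacking a h ∩ Metric.closedBall (0 : EuclideanSpace ℝ (Fin 3)) (23 / 20 * a) := by
      rw [hf]; exact ⟨hx, mem_closedBall_zero_iff.2 hxn⟩
    obtain ⟨⟨y, hy, hyx⟩, -⟩ := hfx
    rw [← hyx, f.symm_apply_apply]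
    exact hy
  refine Set.Subset.antisymm (image_subset_of_patch ha hh1 hh2 f hg hg') fun y hy => ?_
  have hsub := image_subset_of_patch ha hh1 hh2 f.symm hg'
    (fun x hx hxn => by rw [LinearIsometryEquiv.symm_symm]; exact hg x hx hxn)
  exact ⟨f.symm y, hsub ⟨y, hy, rfl⟩, f.apply_symm_apply y⟩

end Summit.AtomisticToContinuum.Crystallization.Theorems.IsometryAtomsMinimisingLawsHaveAtoms

end
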